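import Literature.AlgebraicGeometry.ShimuraVarieties.UnitaryBallHeckeTranslation
import Literature.AlgebraicGeometry.Motives.BettiRealization
import HarnessLib

/-!
# Isometric ball data with conjugate lattices: the quotients are isomorphic, and so is their Betti cohomology

Companion of `UnitaryBallHeckeTranslation` (Hecke translations `[v] ↦ [g v]` for an isometry `g` conjugating
`Γ₁` INTO `Γ₂`).  Here the isometry `g ∈ GL₃(ℂ)`, `gᴴ · H₂^{τ₁} · g = H₁^{τ₁}`, of the complex hermitian spaces of
two ball uniformizations `D₁ : Γ₁\𝔹(V₁) ≅ X₁(ℂ)`, `D₂ : Γ₂\𝔹(V₂) ≅ X₂(ℂ)` conjugates the groups ONTO each other,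
`g · Γ₁^{τ₁} · g⁻¹ = Γ₂^{τ₁}` in `GL₃(ℂ)` — the situation of two hermitian spaces `V₁ ≅ a · V₂` that are SIMILAR over
the CM field (odd rank: any two with the same signatures, Landherr) with a level of `V₂` and its conjugate level of
`V₁`.  Then:

* `conjTranspose_inv_mul_mul_inv` — `g⁻¹` is an isometry the other way; `map_conj_inv_le` — it conjugates `Γ₂^{τ₁}`
  into `Γ₁^{τ₁}`;
* `exists_hom_hom` — under the record `Arapura2012_Cor_15_4_6` (a tree theorem, kept as a hypothesis as in the
  companion file) there are morphisms `f : X₁ ⟶ X₂` over `v ↦ g v` and `f' : X₂ ⟶ X₁` over `w ↦ g⁻¹ w`;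
* `map_comp_apply_of_unif` / `map_comp_apply_of_unif'` — `f ≫ f'` and `f' ≫ f` are the identity on complex points
  (`unif` is onto and `g⁻¹ (g v) = v`);
* `bettiCohomology_map_eq_id_of_forall` — a self-morphism that is the identity on complex points acts as the identity
  on `Hⁱ(X(ℂ); ℚ)` (Betti cohomology is functorial in the continuous map of complex points), hence
  `bettiCohomology_map_comp_hom` — `f^* ∘ f'^* = id`, `f'^* ∘ f^* = id` — and
* **`exists_hom_bettiCohomology_bijective`** — there is a morphism `f : X₁ ⟶ X₂` over `[v] ↦ [g v]` whose pull-back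
  `f^* : Hⁱ(X₂(ℂ); ℚ) → Hⁱ(X₁(ℂ); ℚ)` is BIJECTIVE in every degree: **conjugate arithmetic ball quotients have
  isomorphic rational cohomology, by an algebraic isomorphism**.

All statements are theorems; no definitions, no records.  References: G. Shimura, *Introduction to the arithmetic
theory of automorphic functions* (1971), §7.2–7.3 (isomorphisms of arithmetic quotients induced by `G(ℚ)`-conjugation);
N. Bergeron, J. Millson, C. Moeglin, Acta Math. 216 (2016), Introduction §1.1 (the congruence tower `S(Γ)` and
its `G(ℚ)`-symmetries); D. Arapura, *Algebraic Geometry over the Complex Numbers* (2012), §15.4 Cor. 15.4.6;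
A. Hatcher, *Algebraic Topology* (2002), §3.1 (functoriality of cohomology).

## Provenance

Literature reproduction for the Hodge-ladder cell pub-hodgecm2 (COR-CM, stage 2), seat b06 gen 22, lane «V-TRANSPORT»
(junction-B01 ideation memo IDEA-1g, route L1g-A «one tower per field»): the geometric half of the statement that the
compact Picard modular surfaces of any two hermitian 3-spaces of PerL's signature over the same CM field form
`GL₃`-conjugate towers with isomorphic members.  Every declaration is kernel-checked; nothing is posited.
-/

noncomputable section

open Matrix Function Set
open scoped Manifold Topology
open Literature.NumberTheory.Transcendental
open Literature.AlgebraicGeometry.HodgeTheory (HodgeModel)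
open Literature.AlgebraicGeometry.Motives (SchemeOver ComplexPoints AlgPoints bettiCohomology)
open CategoryTheory

namespace Literature.AlgebraicGeometry.ShimuraVarieties.UnitaryBallIsometricQuotients

open Literature.AlgebraicGeometry.ShimuraVarieties UnitaryBallUniformisationDatum UnitaryBallHeckeTranslation

variable {X₁ X₂ : SchemeOver ℂ} {D₁ : UnitaryBallUniformisationDatum 2 X₁} {D₂ : UnitaryBallUniformisationDatum 2 X₂}
  {g : GL (Fin 3) ℂ}

/-! ### The inverse isometry -/

/-- **The inverse of an isometry is an isometry the other way**: `gᴴ H₂ g = H₁ ⇒ (g⁻¹)ᴴ H₁ g⁻¹ = H₂`.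
[cite: BergeronMillsonMoeglin2016Balls, Part 2 §1.1] -/
theorem conjTranspose_inv_mul_mul_inv (hg : (g : Matrix (Fin 3) (Fin 3) ℂ)ᴴ * D₂.Hℂ * (g : Matrix (Fin 3) (Fin 3) ℂ) = D₁.Hℂ) :
    ((g⁻¹ : GL (Fin 3) ℂ) : Matrix (Fin 3) (Fin 3) ℂ)ᴴ * D₁.Hℂ * ((g⁻¹ : GL (Fin 3) ℂ) : Matrix (Fin 3) (Fin 3) ℂ) =
      D₂.Hℂ := by
  have h1 : (g : Matrix (Fin 3) (Fin 3) ℂ) * ((g⁻¹ : GL (Fin 3) ℂ) : Matrix (Fin 3) (Fin 3) ℂ) = 1 := Units.mul_inv g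
  have h2 : ((g⁻¹ : GL (Fin 3) ℂ) : Matrix (Fin 3) (Fin 3) ℂ)ᴴ * (g : Matrix (Fin 3) (Fin 3) ℂ)ᴴ = 1 := by
    rw [← Matrix.conjTranspose_mul, h1, Matrix.conjTranspose_one]
  rw [← hg]
  calc ((g⁻¹ : GL (Fin 3) ℂ) : Matrix (Fin 3) (Fin 3) ℂ)ᴴ * ((g : Matrix (Fin 3) (Fin 3) ℂ)ᴴ * D₂.Hℂ *
          (g : Matrix (Fin 3) (Fin 3) ℂ)) * ((g⁻¹ : GL (Fin 3) ℂ) : Matrix (Fin 3) (Fin 3) ℂ)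
        = (((g⁻¹ : GL (Fin 3) ℂ) : Matrix (Fin 3) (Fin 3) ℂ)ᴴ * (g : Matrix (Fin 3) (Fin 3) ℂ)ᴴ) * D₂.Hℂ *
            ((g : Matrix (Fin 3) (Fin 3) ℂ) * ((g⁻¹ : GL (Fin 3) ℂ) : Matrix (Fin 3) (Fin 3) ℂ)) := by
          simp only [Matrix.mul_assoc]
    _ = D₂.Hℂ := by rw [h1, h2, Matrix.one_mul, Matrix.mul_one]

/-- **If `g` conjugates `Γ₁^{τ₁}` onto `Γ₂^{τ₁}`, then `g⁻¹` conjugates `Γ₂^{τ₁}` into `Γ₁^{τ₁}`.**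
[cite: Shimura1973, §7.2–7.3] -/
theorem map_conj_inv_le
    (hΓ : (D₁.Γ.map (Matrix.GeneralLinearGroup.map D₁.τ₁)).map (MulAut.conj g).toMonoidHom =
      D₂.Γ.map (Matrix.GeneralLinearGroup.map D₂.τ₁)) :
    (D₂.Γ.map (Matrix.GeneralLinearGroup.map D₂.τ₁)).map (MulAut.conj g⁻¹).toMonoidHom ≤
      D₁.Γ.map (Matrix.GeneralLinearGroup.map D₁.τ₁) := by
  rw [← hΓ, Subgroup.map_map]
  rintro _ ⟨x, hx, rfl⟩
  simpa [MulAut.conj_apply, mul_assoc] using hx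

/-! ### The two morphisms -/

/-- **Isometric ball data with conjugate lattices give morphisms both ways** (under the record
`Arapura2012_Cor_15_4_6`): `f : X₁ ⟶ X₂` with `f(ℂ) (unif₁ v) = unif₂ (g v)` and `f' : X₂ ⟶ X₁` with
`f'(ℂ) (unif₂ w) = unif₁ (g⁻¹ w)` on the cones. [cite: Shimura1973, §7.2–7.3] [cite: Arapura2012, §15.4 Cor. 15.4.6] -/
theorem exists_hom_hom (hA : Arapura2012_Cor_15_4_6) (A₁ : HodgeModel 2 X₁) (A₂ : HodgeModel 2 X₂)
    (hg : (g : Matrix (Fin 3) (Fin 3) ℂ)ᴴ * D₂.Hℂ * (g : Matrix (Fin 3) (Fin 3) ℂ) = D₁.Hℂ)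
    (hΓ : (D₁.Γ.map (Matrix.GeneralLinearGroup.map D₁.τ₁)).map (MulAut.conj g).toMonoidHom =
      D₂.Γ.map (Matrix.GeneralLinearGroup.map D₂.τ₁)) :
    ∃ (f : X₁ ⟶ X₂) (f' : X₂ ⟶ X₁),
      (∀ v ∈ D₁.cone, AlgPoints.map f (D₁.unif v) = D₂.unif ((g : Matrix (Fin 3) (Fin 3) ℂ) *ᵥ v)) ∧
      (∀ w ∈ D₂.cone, AlgPoints.map f' (D₂.unif w) =
        D₁.unif (((g⁻¹ : GL (Fin 3) ℂ) : Matrix (Fin 3) (Fin 3) ℂ) *ᵥ w)) := by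
  obtain ⟨f, hf⟩ := exists_hom_map_unif_mulVec_eq hA hg hΓ.le A₁ A₂
  obtain ⟨f', hf'⟩ := exists_hom_map_unif_mulVec_eq hA (conjTranspose_inv_mul_mul_inv hg) (map_conj_inv_le hΓ) A₂ A₁
  exact ⟨f, f', hf, hf'⟩

/-- **`f ≫ f'` is the identity on complex points**: `unif₁` is onto and `g⁻¹ (g v) = v`.
[cite: Shimura1973, §7.2–7.3] -/
theorem map_comp_apply_of_unif
    (hg : (g : Matrix (Fin 3) (Fin 3) ℂ)ᴴ * D₂.Hℂ * (g : Matrix (Fin 3) (Fin 3) ℂ) = D₁.Hℂ)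
    {f : X₁ ⟶ X₂} {f' : X₂ ⟶ X₁}
    (hf : ∀ v ∈ D₁.cone, AlgPoints.map f (D₁.unif v) = D₂.unif ((g : Matrix (Fin 3) (Fin 3) ℂ) *ᵥ v))
    (hf' : ∀ w ∈ D₂.cone, AlgPoints.map f' (D₂.unif w) =
      D₁.unif (((g⁻¹ : GL (Fin 3) ℂ) : Matrix (Fin 3) (Fin 3) ℂ) *ᵥ w))
    (P : ComplexPoints X₁) : AlgPoints.map (f ≫ f') P = P := by
  obtain ⟨v, hv, rfl⟩ := D₁.surjOn_unif (Set.mem_univ P)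
  rw [AlgPoints.map_comp_apply, hf v hv, hf' _ (mulVec_mem_cone hg hv), Matrix.mulVec_mulVec, ← Units.val_mul,
    inv_mul_cancel, Units.val_one, Matrix.one_mulVec]

/-- **`f' ≫ f` is the identity on complex points**: `unif₂` is onto and `g (g⁻¹ w) = w`.
[cite: Shimura1973, §7.2–7.3] -/
theorem map_comp_apply_of_unif'
    (hg : (g : Matrix (Fin 3) (Fin 3) ℂ)ᴴ * D₂.Hℂ * (g : Matrix (Fin 3) (Fin 3) ℂ) = D₁.Hℂ)
    {f : X₁ ⟶ X₂} {f' : X₂ ⟶ X₁}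
    (hf : ∀ v ∈ D₁.cone, AlgPoints.map f (D₁.unif v) = D₂.unif ((g : Matrix (Fin 3) (Fin 3) ℂ) *ᵥ v))
    (hf' : ∀ w ∈ D₂.cone, AlgPoints.map f' (D₂.unif w) =
      D₁.unif (((g⁻¹ : GL (Fin 3) ℂ) : Matrix (Fin 3) (Fin 3) ℂ) *ᵥ w))
    (Q : ComplexPoints X₂) : AlgPoints.map (f' ≫ f) Q = Q := by
  obtain ⟨w, hw, rfl⟩ := D₂.surjOn_unif (Set.mem_univ Q)
  rw [AlgPoints.map_comp_apply, hf' w hw, hf _ (mulVec_mem_cone (conjTranspose_inv_mul_mul_inv hg) hw),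
    Matrix.mulVec_mulVec, ← Units.val_mul, mul_inv_cancel, Units.val_one, Matrix.one_mulVec]

/-! ### Betti cohomology -/

/-- **A morphism that is the identity on complex points is the identity on Betti cohomology** (`Hⁱ(X(ℂ); ℚ)` is
functorial in the continuous map `X(ℂ) → X(ℂ)`). [cite: HatcherAT2002, §3.1 p. 198] -/
theorem bettiCohomology_map_eq_id_of_forall {X : SchemeOver ℂ} {φ : X ⟶ X} (h : ∀ P : ComplexPoints X, AlgPoints.map φ P = P)
    (i : ℕ) : bettiCohomology.map φ i = 𝟙 _ := by
  have hc : AlgPoints.mapContinuous (L := ℂ) φ = ContinuousMap.id _ := ContinuousMap.ext fun P ↦ by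
    rw [AlgPoints.mapContinuous_apply, h P, ContinuousMap.id_apply]
  rw [bettiCohomology.map, hc, Literature.AlgebraicTopology.SingularHomology.singularCohomology.map_id]

/-- **The pull-backs along `f` and `f'` are mutually inverse** on `Hⁱ(–(ℂ); ℚ)`: `f^* ∘ f'^* = id` on `Hⁱ(X₁(ℂ); ℚ)`
and `f'^* ∘ f^* = id` on `Hⁱ(X₂(ℂ); ℚ)`. [cite: HatcherAT2002, §3.1 p. 198] [cite: Shimura1973, §7.2–7.3] -/
theorem bettiCohomology_map_comp_hom
    (hg : (g : Matrix (Fin 3) (Fin 3) ℂ)ᴴ * D₂.Hℂ * (g : Matrix (Fin 3) (Fin 3) ℂ) = D₁.Hℂ)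
    {f : X₁ ⟶ X₂} {f' : X₂ ⟶ X₁}
    (hf : ∀ v ∈ D₁.cone, AlgPoints.map f (D₁.unif v) = D₂.unif ((g : Matrix (Fin 3) (Fin 3) ℂ) *ᵥ v))
    (hf' : ∀ w ∈ D₂.cone, AlgPoints.map f' (D₂.unif w) =
      D₁.unif (((g⁻¹ : GL (Fin 3) ℂ) : Matrix (Fin 3) (Fin 3) ℂ) *ᵥ w)) (i : ℕ) :
    (bettiCohomology.map f i).hom ∘ₗ (bettiCohomology.map f' i).hom = LinearMap.id ∧
      (bettiCohomology.map f' i).hom ∘ₗ (bettiCohomology.map f i).hom = LinearMap.id := by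
  constructor
  · have h := bettiCohomology_map_eq_id_of_forall (map_comp_apply_of_unif hg hf hf') i
    rw [bettiCohomology.map_comp] at h
    have h' := congrArg ModuleCat.Hom.hom h
    rwa [ModuleCat.hom_comp, ModuleCat.hom_id] at h'
  · have h := bettiCohomology_map_eq_id_of_forall (map_comp_apply_of_unif' hg hf hf') i
    rw [bettiCohomology.map_comp] at h
    have h' := congrArg ModuleCat.Hom.hom h
    rwa [ModuleCat.hom_comp, ModuleCat.hom_id] at h'

/-- **The pull-back `f^* : Hⁱ(X₂(ℂ); ℚ) → Hⁱ(X₁(ℂ); ℚ)` along the translation `f` is bijective** in every degree.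
[cite: Shimura1973, §7.2–7.3] [cite: HatcherAT2002, §3.1 p. 198] -/
theorem bettiCohomology_map_bijective
    (hg : (g : Matrix (Fin 3) (Fin 3) ℂ)ᴴ * D₂.Hℂ * (g : Matrix (Fin 3) (Fin 3) ℂ) = D₁.Hℂ)
    {f : X₁ ⟶ X₂} {f' : X₂ ⟶ X₁}
    (hf : ∀ v ∈ D₁.cone, AlgPoints.map f (D₁.unif v) = D₂.unif ((g : Matrix (Fin 3) (Fin 3) ℂ) *ᵥ v))
    (hf' : ∀ w ∈ D₂.cone, AlgPoints.map f' (D₂.unif w) =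
      D₁.unif (((g⁻¹ : GL (Fin 3) ℂ) : Matrix (Fin 3) (Fin 3) ℂ) *ᵥ w)) (i : ℕ) :
    Function.Bijective (bettiCohomology.map f i).hom := by
  obtain ⟨h1, h2⟩ := bettiCohomology_map_comp_hom hg hf hf' i
  refine ⟨Function.LeftInverse.injective (g := (bettiCohomology.map f' i).hom) fun x ↦ ?_,
    Function.RightInverse.surjective (g := (bettiCohomology.map f' i).hom) fun x ↦ ?_⟩
  · exact LinearMap.congr_fun h2 x
  · exact LinearMap.congr_fun h1 x

/-- **Conjugate arithmetic ball quotients are algebraically isomorphic, with isomorphic rational cohomology**: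
for an isometry `g` with `g Γ₁^{τ₁} g⁻¹ = Γ₂^{τ₁}` there is a morphism `f : X₁ ⟶ X₂` over `[v] ↦ [g v]` whose pull-back
on `Hⁱ(–(ℂ); ℚ)` is bijective in every degree (under the record `Arapura2012_Cor_15_4_6`, a tree theorem).
[cite: Shimura1973, §7.2–7.3] [cite: BergeronMillsonMoeglin2016Balls, Introduction §1.1] [cite: Arapura2012, §15.4 Cor. 15.4.6] -/
theorem exists_hom_bettiCohomology_bijective (hA : Arapura2012_Cor_15_4_6) (hA₁ : Nonempty (HodgeModel 2 X₁))
    (hA₂ : Nonempty (HodgeModel 2 X₂))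
    (hg : (g : Matrix (Fin 3) (Fin 3) ℂ)ᴴ * D₂.Hℂ * (g : Matrix (Fin 3) (Fin 3) ℂ) = D₁.Hℂ)
    (hΓ : (D₁.Γ.map (Matrix.GeneralLinearGroup.map D₁.τ₁)).map (MulAut.conj g).toMonoidHom =
      D₂.Γ.map (Matrix.GeneralLinearGroup.map D₂.τ₁)) :
    ∃ f : X₁ ⟶ X₂, (∀ v ∈ D₁.cone, AlgPoints.map f (D₁.unif v) = D₂.unif ((g : Matrix (Fin 3) (Fin 3) ℂ) *ᵥ v)) ∧
      ∀ i : ℕ, Function.Bijective (bettiCohomology.map f i).hom := by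
  obtain ⟨A₁⟩ := hA₁
  obtain ⟨A₂⟩ := hA₂
  obtain ⟨f, f', hf, hf'⟩ := exists_hom_hom hA A₁ A₂ hg hΓ
  exact ⟨f, hf, fun i ↦ bettiCohomology_map_bijective hg hf hf' i⟩

end Literature.AlgebraicGeometry.ShimuraVarieties.UnitaryBallIsometricQuotients

end
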